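import Summits.Langlands.Langlands.Theses.SplitPrimeInduction
import Literature.NumberTheory.NumberFields.PureCubicDegreeOnePrimes

/-!
# `MonomialSerreAtSplitPrimes` (stmt-Langlands-16951), negative side IV: primes of a pure cubic field

Negative-side lemmas (refuter, crux attack at birth, 2026-08-17; supports stmt-Langlands-16951): the
number-field input for the witness `F = ℚ(∛2)` of the refutation of the crux, part 1 of 2
(`PureCubicPrimes → PureCubicTwoSplitData`).  For a cubic number field `K ∋ θ`, `θ³ = m` not a cube,
and a prime `p ∤ 3m` (Dedekind–Kummer applies: the conductor exponent of `θ` divides `27m²`, tree file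
`Literature.NumberTheory.NumberFields.PureCubicDegreeOnePrimes`):

* §7 `exists_factor_of_mem_primesOver`: a prime `P ∣ p` corresponds to a monic irreducible factor `Q`
  of `X³ - m (mod p)` with `f(P/p) = deg Q` and `e(P/p) = mult_Q(X³ - m)` (Mathlib
  `NumberField.Ideal.primesOverSpanEquivMonicFactorsMod` and its `inertiaDeg_…`/`ramificationIdx_…`
  lemmas, in the NEW `Ideal.inertiaDeg / Ideal.ramificationIdx` typing used by the crux);
  `primesOver_of_two_factors`: a factorisation `X³ - m ≡ Q₁ Q₂` into two distinct monic irreducibles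
  gives exactly two primes over `p`, of residue degrees `deg Q₁, deg Q₂`.
* §8: over `𝔽_ℓ`, `ℓ ≡ 2 (mod 3)`, cubing is a bijection, and `X³ - r³ = (X - r)(X² + rX + r²)` with
  the quadratic irreducible (`r ≠ 0`).
* §9 (bridge to the crux's typing over `𝓞 ℚ`): if the primes of `𝓞 K` over `(ℓ) ⊂ ℤ` are exactly
  `P₁ ≠ P₂`, then over the place of `ℚ` containing `ℓ` there are exactly the two places `P₁, P₂`, with
  the same residue degrees over `𝓞 ℚ` as over `ℤ` (`f((ℓ)𝓞_ℚ / ℤ) = 1`, `inertiaDeg_tower`).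

References: H. Cohen, GTM 138 (1993), §4.8.2 Thm. 4.8.13, §6.4 [Cohen1993]; D. A. Marcus, *Number
Fields* (2018), Ch. 3 Thm. 27 [Marcus2018].
-/

noncomputable section

set_option linter.dupNamespace false -- `Summit.Langlands.Langlands` is the mandated namespace (D-0017)

open scoped NumberField Polynomial
open IsDedekindDomain NumberField Polynomial Ideal
open Literature.NumberTheory.NumberFields Literature.NumberTheory.NumberFields.MonicCubic
  Literature.NumberTheory.NumberFields.PureCubic

namespace Summit.Langlands.Langlands.Theorems.MonomialSerreAtSplitPrimes.Negative

/-! ## 7. Dedekind–Kummer data for a pure cubic field `K ∋ θ`, `θ³ = m` -/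

section PureCubicGeneral

variable {K : Type} [Field K] [NumberField K] {m : ℕ} {θ : 𝓞 K}

/-- `minpoly_ℤ θ (mod p) = X³ - m` for `θ³ = m` not a cube. [folklore] -/
theorem map_minpoly_eq (hm : ∀ r : ℕ, r ^ 3 ≠ m) (hθ : θ ^ 3 = (m : 𝓞 K)) (p : ℕ) :
    (minpoly ℤ θ).map (Int.castRingHom (ZMod p)) = X ^ 3 - C (m : ZMod p) := by
  have hmin : minpoly ℤ θ = poly 0 0 (-(m : ℤ)) := by
    rw [← thetaInt_eq hθ]; exact minpoly_thetaInt (irreducible_polyQ hm) (aeval_poly hθ)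
  rw [hmin, poly]
  simp [Polynomial.map_pow, sub_eq_add_neg]

/-- **Dedekind–Kummer for `ℚ(∛m)` at `p ∤ 3m`**: a prime `P` of `𝓞 K` over `p` corresponds to a monic
irreducible factor `Q` of `X³ - m (mod p)`, with residue degree `deg Q` and ramification index the
multiplicity of `Q` (Mathlib `NumberField.Ideal.primesOverSpanEquivMonicFactorsMod`).
[cite: Cohen1993, §4.8.2 Thm. 4.8.13 and §6.4] -/
theorem exists_factor_of_mem_primesOver (h3 : Module.finrank ℚ K = 3) (hm : ∀ r : ℕ, r ^ 3 ≠ m)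
    (hθ : θ ^ 3 = (m : 𝓞 K)) {p : ℕ} (hp : p.Prime) (hpm : ¬ p ∣ 3 * m) {P : Ideal (𝓞 K)}
    (hP : P ∈ primesOver (span {(p : ℤ)}) (𝓞 K)) :
    ∃ Q : (ZMod p)[X], Irreducible Q ∧ Q.Monic ∧ Q ∣ X ^ 3 - C (m : ZMod p) ∧
      P.inertiaDeg ℤ = Q.natDegree ∧ P.ramificationIdx ℤ = multiplicity Q (X ^ 3 - C (m : ZMod p)) := by
  classical
  haveI := Fact.mk hp
  have hexp : ¬ p ∣ RingOfIntegers.exponent θ := not_dvd_exponent h3 hm hθ hp hpm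
  set e := NumberField.Ideal.primesOverSpanEquivMonicFactorsMod (K := K) hexp
  set Q := e ⟨P, hP⟩ with hQ
  have hmem : (Q : (ZMod p)[X]) ∈ RingOfIntegers.monicFactorsMod θ p := Q.2
  have hmem' := hmem
  simp only [RingOfIntegers.monicFactorsMod, Multiset.mem_toFinset, map_minpoly_eq hm hθ] at hmem'
  have h0 : (X ^ 3 - C (m : ZMod p) : (ZMod p)[X]) ≠ 0 := (monic_X_pow_sub_C _ three_ne_zero).ne_zero
  obtain ⟨hirr, hmon, hdvd⟩ := (Polynomial.mem_normalizedFactors_iff h0).mp hmem'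
  refine ⟨Q, hirr, hmon, hdvd, ?_, ?_⟩
  · have := NumberField.Ideal.inertiaDeg_primesOverSpanEquivMonicFactorsMod_symm_apply' hexp hmem
    rwa [show (⟨(Q : (ZMod p)[X]), hmem⟩ : RingOfIntegers.monicFactorsMod θ p) = Q from Subtype.ext rfl,
      Equiv.symm_apply_apply] at this
  · have := NumberField.Ideal.ramificationIdx_primesOverSpanEquivMonicFactorsMod_symm_apply' hexp hmem
    rwa [show (⟨(Q : (ZMod p)[X]), hmem⟩ : RingOfIntegers.monicFactorsMod θ p) = Q from Subtype.ext rfl,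
      Equiv.symm_apply_apply, map_minpoly_eq hm hθ] at this

/-- **The primes over `p ∤ 3m` from a factorisation `X³ - m ≡ Q₁ · Q₂ (mod p)` into two DISTINCT monic
irreducibles**: there are exactly two primes of `𝓞 K` over `p`, of residue degrees `deg Q₁`, `deg Q₂`.
[cite: Cohen1993, §4.8.2 Thm. 4.8.13] -/
theorem primesOver_of_two_factors (h3 : Module.finrank ℚ K = 3) (hm : ∀ r : ℕ, r ^ 3 ≠ m)
    (hθ : θ ^ 3 = (m : 𝓞 K)) {p : ℕ} (hp : p.Prime) (hpm : ¬ p ∣ 3 * m) {Q₁ Q₂ : (ZMod p)[X]}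
    (h₁ : Irreducible Q₁) (h₁m : Q₁.Monic) (h₂ : Irreducible Q₂) (h₂m : Q₂.Monic) (hne : Q₁ ≠ Q₂)
    (hfac : (X ^ 3 - C (m : ZMod p) : (ZMod p)[X]) = Q₁ * Q₂) :
    ∃ P₁ P₂ : Ideal (𝓞 K), P₁ ≠ P₂ ∧ primesOver (span {(p : ℤ)}) (𝓞 K) = {P₁, P₂} ∧
      P₁.inertiaDeg ℤ = Q₁.natDegree ∧ P₂.inertiaDeg ℤ = Q₂.natDegree := by
  classical
  haveI := Fact.mk hp
  have hexp : ¬ p ∣ RingOfIntegers.exponent θ := not_dvd_exponent h3 hm hθ hp hpm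
  set e := NumberField.Ideal.primesOverSpanEquivMonicFactorsMod (K := K) hexp
  have h0 : (X ^ 3 - C (m : ZMod p) : (ZMod p)[X]) ≠ 0 := (monic_X_pow_sub_C _ three_ne_zero).ne_zero
  have hmem₁ : Q₁ ∈ RingOfIntegers.monicFactorsMod θ p := by
    simp only [RingOfIntegers.monicFactorsMod, Multiset.mem_toFinset, map_minpoly_eq hm hθ]
    exact (Polynomial.mem_normalizedFactors_iff h0).mpr ⟨h₁, h₁m, hfac ▸ dvd_mul_right _ _⟩
  have hmem₂ : Q₂ ∈ RingOfIntegers.monicFactorsMod θ p := by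
    simp only [RingOfIntegers.monicFactorsMod, Multiset.mem_toFinset, map_minpoly_eq hm hθ]
    exact (Polynomial.mem_normalizedFactors_iff h0).mpr ⟨h₂, h₂m, hfac ▸ dvd_mul_left _ _⟩
  refine ⟨e.symm ⟨Q₁, hmem₁⟩, e.symm ⟨Q₂, hmem₂⟩, ?_, ?_, ?_, ?_⟩
  · intro h
    have := e.symm.injective (Subtype.ext h)
    exact hne (congrArg Subtype.val this)
  · ext P
    simp only [Set.mem_insert_iff, Set.mem_singleton_iff]
    constructor
    · intro hP
      -- the factor attached to `P` divides `Q₁ Q₂`, hence is one of them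
      set Q := e ⟨P, hP⟩ with hQ
      have hmem : (Q : (ZMod p)[X]) ∈ RingOfIntegers.monicFactorsMod θ p := Q.2
      have hmem' := hmem
      simp only [RingOfIntegers.monicFactorsMod, Multiset.mem_toFinset, map_minpoly_eq hm hθ] at hmem'
      obtain ⟨hirr, hmon, hdvd⟩ := (Polynomial.mem_normalizedFactors_iff h0).mp hmem'
      rw [hfac] at hdvd
      have hP' : P = ((e.symm Q : primesOver (span {(p : ℤ)}) (𝓞 K)) : Ideal (𝓞 K)) := by
        rw [hQ, Equiv.symm_apply_apply]
      rcases hirr.prime.dvd_or_dvd hdvd with hd | hd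
      · left
        have hQ₁ : (Q : (ZMod p)[X]) = Q₁ := eq_of_monic_of_associated hmon h₁m (hirr.associated_of_dvd h₁ hd)
        rw [hP']
        congr 1
        exact congrArg e.symm (Subtype.ext hQ₁)
      · right
        have hQ₂ : (Q : (ZMod p)[X]) = Q₂ := eq_of_monic_of_associated hmon h₂m (hirr.associated_of_dvd h₂ hd)
        rw [hP']
        congr 1
        exact congrArg e.symm (Subtype.ext hQ₂)
    · rintro (rfl | rfl)
      · exact (e.symm ⟨Q₁, hmem₁⟩).2
      · exact (e.symm ⟨Q₂, hmem₂⟩).2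
  · exact NumberField.Ideal.inertiaDeg_primesOverSpanEquivMonicFactorsMod_symm_apply' hexp hmem₁
  · exact NumberField.Ideal.inertiaDeg_primesOverSpanEquivMonicFactorsMod_symm_apply' hexp hmem₂

end PureCubicGeneral

/-! ## 8. `X³ - 2` modulo a prime `ℓ ≡ 2 (mod 3)`: a linear times an irreducible quadratic factor -/

section CubeMap

variable {ℓ : ℕ} [hℓ : Fact ℓ.Prime]

/-- For `ℓ ≡ 2 (mod 3)` cubing is injective on `𝔽_ℓ` (`x = (x³)^{-t}` with `ℓ - 1 = 3t + 1`).
[folklore] -/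
theorem cube_injective (h3 : ℓ % 3 = 2) : Function.Injective fun x : ZMod ℓ => x ^ 3 := by
  intro x y hxy
  simp only at hxy
  -- `ℓ - 1 = 3 t + 1`
  obtain ⟨t, ht⟩ : ∃ t, ℓ - 1 = 3 * t + 1 := ⟨ℓ / 3, by have := Nat.div_add_mod ℓ 3; omega⟩
  have key : ∀ z : ZMod ℓ, z ≠ 0 → z = ((z ^ 3) ^ t)⁻¹ := by
    intro z hz
    have h1 : z ^ (ℓ - 1) = 1 := ZMod.pow_card_sub_one_eq_one hz
    rw [ht, pow_succ, pow_mul] at h1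
    exact (eq_inv_of_mul_eq_one_right h1)
  by_cases hx : x = 0
  · subst hx
    simp only [ne_eq, OfNat.ofNat_ne_zero, not_false_eq_true, zero_pow] at hxy
    exact (pow_eq_zero_iff three_ne_zero).1 hxy.symm |>.symm
  by_cases hy : y = 0
  · subst hy
    simp only [ne_eq, OfNat.ofNat_ne_zero, not_false_eq_true, zero_pow] at hxy
    exact (pow_eq_zero_iff three_ne_zero).1 hxy
  rw [key x hx, key y hy, hxy]

/-- Hence for `ℓ ≡ 2 (mod 3)` every element of `𝔽_ℓ` is a cube. [folklore] -/
theorem cube_surjective (h3 : ℓ % 3 = 2) : Function.Surjective fun x : ZMod ℓ => x ^ 3 :=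
  Finite.surjective_of_injective (cube_injective h3)

/-- **`X³ - c = (X - r)(X² + rX + r²)` with the quadratic IRREDUCIBLE** over `𝔽_ℓ`, `ℓ ≡ 2 (mod 3)`,
`ℓ ≠ 2`, `r³ = c ≠ 0`: a root `s` of the quadratic has `s³ = c = r³`, so `s = r` and `3r² = 0`.
[folklore] -/
theorem quadratic_irreducible (h3 : ℓ % 3 = 2) {r : ZMod ℓ} (hr : r ≠ 0) :
    Irreducible (X ^ 2 + C r * X + C (r ^ 2) : (ZMod ℓ)[X]) := by
  have hdeg : (X ^ 2 + C r * X + C (r ^ 2) : (ZMod ℓ)[X]).natDegree = 2 := by compute_degree!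
  refine irreducible_of_degree_le_three_of_not_isRoot (by rw [hdeg]; decide) fun s hs => ?_
  rw [IsRoot.def] at hs
  simp only [eval_add, eval_pow, eval_X, eval_mul, eval_C] at hs
  -- `s³ = r³`
  have hs3 : s ^ 3 = r ^ 3 := by linear_combination (s - r) * hs
  have hsr : s = r := cube_injective h3 hs3
  subst hsr
  have h3s : (3 : ZMod ℓ) * s ^ 2 = 0 := by linear_combination hs
  have h3ne : (3 : ZMod ℓ) ≠ 0 := by
    intro h
    have : ((3 : ℕ) : ZMod ℓ) = 0 := by exact_mod_cast h
    rw [ZMod.natCast_eq_zero_iff] at this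
    have := (Nat.prime_dvd_prime_iff_eq hℓ.out Nat.prime_three).1 this
    omega
  exact hr (pow_eq_zero_iff two_ne_zero |>.1 ((mul_eq_zero.1 h3s).resolve_left h3ne))

/-- The factorisation `X³ - r³ = (X - r)(X² + rX + r²)`. [folklore] -/
theorem X_pow_three_sub_eq_mul (r : ZMod ℓ) :
    (X ^ 3 - C (r ^ 3) : (ZMod ℓ)[X]) = (X - C r) * (X ^ 2 + C r * X + C (r ^ 2)) := by
  simp only [map_pow]
  ring

/-- The two factors are distinct (degrees `1 ≠ 2`). [folklore] -/
theorem X_sub_C_ne_quadratic (r : ZMod ℓ) :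
    (X - C r : (ZMod ℓ)[X]) ≠ X ^ 2 + C r * X + C (r ^ 2) := by
  intro h
  have h1 : (X - C r : (ZMod ℓ)[X]).natDegree = 1 := natDegree_X_sub_C r
  have h2 : (X ^ 2 + C r * X + C (r ^ 2) : (ZMod ℓ)[X]).natDegree = 2 := by compute_degree!
  rw [h, h2] at h1
  exact absurd h1 (by decide)

end CubeMap

/-! ## 9. From primes over `(ℓ) ⊂ ℤ` to places over the place `(ℓ)` of `ℚ` -/

section Bridge

variable {K : Type} [Field K] [NumberField K]

omit [NumberField K] in
/-- A prime of `ℤ` below an ideal containing the rational prime `ℓ` is `(ℓ)`. [folklore] -/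
theorem int_under_eq_span {I : Ideal (𝓞 K)} [I.IsPrime] {ℓ : ℕ} (hℓ : ℓ.Prime)
    (h : (ℓ : 𝓞 K) ∈ I) : I.under ℤ = span {(ℓ : ℤ)} := by
  have hp0 : (span {(ℓ : ℤ)}) ≠ ⊥ := by simp [hℓ.ne_zero]
  have hmax : (span {(ℓ : ℤ)}).IsMaximal :=
    ((span_singleton_prime (by exact_mod_cast hℓ.ne_zero)).mpr
      (Nat.prime_iff_prime_int.mp hℓ)).isMaximal hp0
  refine (hmax.eq_of_le (Ideal.IsPrime.under ℤ I).ne_top ?_).symm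
  rw [span_singleton_le_iff_mem, Ideal.mem_comap, map_natCast]
  exact h

/-- `(ℓ) ⊂ 𝓞 ℚ` is maximal (its norm `ℓ` is prime). [folklore] -/
theorem ratInt_span_isMaximal {ℓ : ℕ} (hℓ : ℓ.Prime) : (span {(ℓ : 𝓞 ℚ)}).IsMaximal := by
  have habs : Ideal.absNorm (span {(ℓ : 𝓞 ℚ)}) = ℓ := by
    rw [Ideal.absNorm_span_singleton, show ((ℓ : ℕ) : 𝓞 ℚ) = algebraMap ℤ (𝓞 ℚ) (ℓ : ℤ) by simp,
      Algebra.norm_algebraMap, RingOfIntegers.rank, Module.finrank_self, pow_one, Int.natAbs_natCast]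
  have hpr : (span {(ℓ : 𝓞 ℚ)}).IsPrime :=
    Ideal.isPrime_of_irreducible_absNorm (by rw [habs]; exact hℓ)
  exact hpr.isMaximal (by rw [Ne, Ideal.span_singleton_eq_bot]; exact_mod_cast hℓ.ne_zero)

/-- A prime of `𝓞 ℚ` containing `ℓ` is `(ℓ)`. [folklore] -/
theorem ratInt_eq_span_of_mem {ℓ : ℕ} (hℓ : ℓ.Prime) {Q : Ideal (𝓞 ℚ)} [hQ : Q.IsPrime]
    (h : (ℓ : 𝓞 ℚ) ∈ Q) : Q = span {(ℓ : 𝓞 ℚ)} :=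
  ((ratInt_span_isMaximal hℓ).eq_of_le hQ.ne_top ((span_singleton_le_iff_mem _).2 h)).symm

/-- The residue degree over `ℤ` of the place of `ℚ` containing `ℓ` is `1` (`N(ℓ) = ℓ`). [folklore] -/
theorem ratInt_inertiaDeg_eq_one {ℓ : ℕ} (hℓ : ℓ.Prime) (v : HeightOneSpectrum (𝓞 ℚ))
    (hv : (ℓ : 𝓞 ℚ) ∈ v.asIdeal) : v.asIdeal.inertiaDeg ℤ = 1 := by
  haveI : v.asIdeal.LiesOver (span {(ℓ : ℤ)}) := ⟨(int_under_eq_span hℓ hv).symm⟩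
  have h := Ideal.pow_inertiaDeg ℓ v.asIdeal
  have habs : Ideal.absNorm v.asIdeal = ℓ := by
    rw [ratInt_eq_span_of_mem hℓ hv, Ideal.absNorm_span_singleton,
      show ((ℓ : ℕ) : 𝓞 ℚ) = algebraMap ℤ (𝓞 ℚ) (ℓ : ℤ) by simp, Algebra.norm_algebraMap,
      RingOfIntegers.rank, Module.finrank_self, pow_one, Int.natAbs_natCast]
  rw [habs] at h
  exact Nat.pow_right_injective hℓ.two_le (h.trans (pow_one ℓ).symm)

omit [NumberField K] in
/-- A prime `P` of `𝓞 K` over `(ℓ) ⊂ ℤ` contains `ℓ`, hence is nonzero. [folklore] -/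
theorem natCast_mem_of_mem_primesOver {ℓ : ℕ} {P : Ideal (𝓞 K)}
    (hP : P ∈ primesOver (span {(ℓ : ℤ)}) (𝓞 K)) : (ℓ : 𝓞 K) ∈ P := by
  have h : (ℓ : ℤ) ∈ P.under ℤ := by
    rw [← hP.2.over]; exact mem_span_singleton_self _
  rw [Ideal.mem_comap, map_natCast] at h
  exact h

/-- **Bridge.**  If the primes of `𝓞 K` over `(ℓ) ⊂ ℤ` are exactly `P₁ ≠ P₂`, then over the place of
`ℚ` containing `ℓ` there are exactly the two places `P₁, P₂`, with residue degrees over `𝓞 ℚ` equal to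
those over `ℤ` (the residue degree of `(ℓ) ⊂ 𝓞 ℚ` over `ℤ` being `1`). [folklore] -/
theorem places_over_of_primesOver {ℓ : ℕ} (hℓ : ℓ.Prime) {P₁ P₂ : Ideal (𝓞 K)} (hne : P₁ ≠ P₂)
    (hprimes : primesOver (span {(ℓ : ℤ)}) (𝓞 K) = {P₁, P₂})
    (v : HeightOneSpectrum (𝓞 ℚ)) (hv : (ℓ : 𝓞 ℚ) ∈ v.asIdeal) :
    ∃ w₁ w₂ : HeightOneSpectrum (𝓞 K), w₁ ≠ w₂ ∧
      {w : HeightOneSpectrum (𝓞 K) | w.asIdeal.under (𝓞 ℚ) = v.asIdeal} = {w₁, w₂} ∧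
      w₁.asIdeal.inertiaDeg (𝓞 ℚ) = P₁.inertiaDeg ℤ ∧ w₂.asIdeal.inertiaDeg (𝓞 ℚ) = P₂.inertiaDeg ℤ := by
  have hP₁ : P₁ ∈ primesOver (span {(ℓ : ℤ)}) (𝓞 K) := by rw [hprimes]; exact Set.mem_insert _ _
  have hP₂ : P₂ ∈ primesOver (span {(ℓ : ℤ)}) (𝓞 K) := by
    rw [hprimes]; exact Set.mem_insert_of_mem _ rfl
  have hℓ0 : (ℓ : 𝓞 K) ≠ 0 := by exact_mod_cast hℓ.ne_zero
  -- under `𝓞 ℚ`, every prime over `(ℓ)` lies over `v`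
  have hunder : ∀ {P : Ideal (𝓞 K)}, P ∈ primesOver (span {(ℓ : ℤ)}) (𝓞 K) →
      P.under (𝓞 ℚ) = v.asIdeal := by
    intro P hP
    haveI := hP.1
    have hmem : (ℓ : 𝓞 ℚ) ∈ P.under (𝓞 ℚ) := by
      rw [Ideal.mem_comap, map_natCast]; exact natCast_mem_of_mem_primesOver hP
    rw [ratInt_eq_span_of_mem hℓ hmem, ratInt_eq_span_of_mem hℓ hv]
  let w₁ : HeightOneSpectrum (𝓞 K) :=
    ⟨P₁, hP₁.1, fun h => hℓ0 (by simpa [h] using natCast_mem_of_mem_primesOver hP₁)⟩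
  let w₂ : HeightOneSpectrum (𝓞 K) :=
    ⟨P₂, hP₂.1, fun h => hℓ0 (by simpa [h] using natCast_mem_of_mem_primesOver hP₂)⟩
  refine ⟨w₁, w₂, fun h => hne (congrArg HeightOneSpectrum.asIdeal h), ?_, ?_, ?_⟩
  · ext w
    simp only [Set.mem_setOf_eq, Set.mem_insert_iff, Set.mem_singleton_iff]
    constructor
    · intro hw
      have hmemK : (ℓ : 𝓞 K) ∈ w.asIdeal := by
        have : (ℓ : 𝓞 ℚ) ∈ w.asIdeal.under (𝓞 ℚ) := hw ▸ hv
        rw [Ideal.mem_comap, map_natCast] at this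
        exact this
      have hwP : w.asIdeal ∈ primesOver (span {(ℓ : ℤ)}) (𝓞 K) :=
        ⟨w.isPrime, ⟨(int_under_eq_span hℓ hmemK).symm⟩⟩
      rw [hprimes] at hwP
      rcases hwP with h | h
      · exact Or.inl (HeightOneSpectrum.ext h)
      · exact Or.inr (HeightOneSpectrum.ext h)
    · rintro (rfl | rfl)
      · exact hunder hP₁
      · exact hunder hP₂
  · haveI := hP₁.1
    haveI : P₁.LiesOver v.asIdeal := ⟨(hunder hP₁).symm⟩
    have ht := Ideal.inertiaDeg_tower (R := ℤ) v.asIdeal P₁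
    rw [ratInt_inertiaDeg_eq_one hℓ v hv, one_mul] at ht
    exact ht.symm
  · haveI := hP₂.1
    haveI : P₂.LiesOver v.asIdeal := ⟨(hunder hP₂).symm⟩
    have ht := Ideal.inertiaDeg_tower (R := ℤ) v.asIdeal P₂
    rw [ratInt_inertiaDeg_eq_one hℓ v hv, one_mul] at ht
    exact ht.symm

end Bridge

end Summit.Langlands.Langlands.Theorems.MonomialSerreAtSplitPrimes.Negative

end
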